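import Summits.Ventures.PercRepro.ExcessOneProjection

/-!
# (SD): a family of Marica–Schönheim excess at most one has every nontrivial twin-free
element among its singleton differences

Let `F` be a family of finite sets with `|F \\ F| ≤ |F| + 1` (Marica–Schönheim excess at most
one), and let `r` be an element lying in some member and outside some member whose twin class is
`{r}`. Then `{r}` is a difference of `F` (`singleton_mem_diffs_of_card_diffs_le`). This is the
conjecture (SD) of proofs/MINE1-theoremS.md, Addendum 17; its paper proof is Addendum 20.

The proof is a strong induction on a support `u ⊇ ⋃ F`, by contradiction. Write `D := F \\ F`
and suppose `{r} ∉ D`.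

* The trace `P := proj r F` is not tight — otherwise Lemma A⁺ in trace form
  (`card_add_two_le_card_diffs_of_singleton_notMem`) gives `|D| ≥ |F| + 2` — so the identity
  `|D| = |P \\ P| + |X ∩ Y|` forces `X ∩ Y = ∅`: **no difference `d ∌ r` has `insert r d ∈ D`**.
* Every single-element projection `proj a F` again has excess at most one
  (`card_diffs_proj_add_card_partner_le`), and `r` stays nontrivial and twin-free in it, so the
  induction hypothesis gives `{r} ∈ proj a F \\ proj a F`, i.e. `{a, r} ∈ D` for every `a ∈ u`,
  `a ≠ r`. With the first bullet, **no singleton `{a}` (`a ≠ r`) is a difference**, every such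
  `a` is nontrivial and twin-free, and — applying the induction hypothesis at a second element
  `r'` — every pair `{a, r'}` is a difference as well.
* **The count.** Project along the pair `A = {r, r'}`: `Q := {t \ A}`, `D_A := {d \ A} = Q \\ Q`.
  By `card_le_card_image_sdiff_add_card_diag`, `|F| ≤ |Q| + |K'|` with
  `K' := {v ∈ F : v ∩ A = ∅, v ∪ A ∈ F}` (the only subsets of `A` among the differences are `∅`
  and `A`); by `card_image_sdiff_add_card_diffs_diag_add_card_le`,
  `|D_A| + |K' \\ K'| + |u \ A| ≤ |D|`. Marica–Schönheim for `Q` and for `K'` then gives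
  `|u \ A| ≤ 1`, while `u \ A` has at least two elements.
-/

namespace PercRepro.MSTight

open Finset
open scoped FinsetFamily

variable {α : Type*} [DecidableEq α] [Fintype α]

/-- **(SD) with an explicit support** (the inductive form): if every member of `F` lies in `u`,
`|F \\ F| ≤ |F| + 1`, and `r` is a twin-free element in some member and outside some member,
then `{r}` is a difference of `F`. -/
theorem singleton_mem_diffs_of_card_diffs_le_aux (u : Finset α) :
    ∀ (F : Finset (Finset α)), (∀ t ∈ F, t ⊆ u) → (F \\ F).card ≤ F.card + 1 →
      ∀ r : α, (∀ b, Twin F r b → b = r) → (∃ t ∈ F, r ∈ t) → (∃ t ∈ F, r ∉ t) →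
        ({r} : Finset α) ∈ F \\ F := by
  induction u using Finset.strongInduction with
  | H u ih =>
  intro F hFu hF r htw hin hout
  by_contra hnot
  -- the induction hypothesis applied to the projection along `a ∈ u`
  have hproj : ∀ a ∈ u, ∀ x, x ≠ a → (∀ b, Twin F x b → b = x) → (∃ t ∈ F, x ∈ t) →
      (∃ t ∈ F, x ∉ t) →
      ({x} : Finset α) ∈ F \\ F ∨ insert a ({x} : Finset α) ∈ F \\ F := by
    intro a ha x hxa htwx hinx houtx
    rw [← singleton_mem_diffs_proj_iff hxa]
    refine ih (u.erase a) (erase_ssubset ha) (proj a F) ?_ ?_ x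
      (twin_proj_eq_of_twin_eq hxa htwx hinx) ?_ ?_
    · intro t ht
      obtain ⟨s, hs, rfl⟩ := mem_proj.1 ht
      exact erase_subset_erase a (hFu s hs)
    · have h1 := card_diffs_proj_add_card_partner_le a F
      have h2 := card_eq_card_proj_add_card_partner a F
      omega
    · obtain ⟨t, ht, hxt⟩ := hinx
      exact ⟨t.erase a, mem_proj.2 ⟨t, ht, rfl⟩, mem_erase.2 ⟨hxa, hxt⟩⟩
    · obtain ⟨t, ht, hxt⟩ := houtx
      exact ⟨t.erase a, mem_proj.2 ⟨t, ht, rfl⟩, fun h => hxt (mem_of_mem_erase h)⟩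
  -- (1) no difference `d ∌ r` has `insert r d` a difference
  have hK : partner r F = ∅ := partner_eq_empty_of_singleton_notMem hnot
  have hcardP : F.card = (proj r F).card := by
    rw [card_eq_card_proj_add_card_partner r F, hK, card_empty, add_zero]
  have hPnt : ¬ Tight (proj r F) := fun hP => by
    have := card_add_two_le_card_diffs_of_singleton_notMem htw hin hout hnot hP
    omega
  have hPlt : (proj r F).card < (proj r F \\ proj r F).card :=
    Nat.lt_of_le_of_ne (card_le_card_diffs _) (fun h => hPnt h.symm)
  have hXY : ∀ d ∈ F \\ F, r ∉ d → insert r d ∉ F \\ F := by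
    intro d hd hrd hrd'
    have h1 := card_diffs_eq_card_diffs_proj_add r F
    have h2 : d ∈ diffsX r F ∩ diffsY r F :=
      mem_inter.2 ⟨mem_diffsX_iff.2 ⟨hd, hrd⟩, mem_diffsY_iff.2 ⟨hrd, hrd'⟩⟩
    have h3 : 0 < (diffsX r F ∩ diffsY r F).card := card_pos.2 ⟨d, h2⟩
    omega
  -- (2) every pair `{a, r}` is a difference
  have hpr : ∀ a ∈ u, a ≠ r → insert a ({r} : Finset α) ∈ F \\ F := by
    intro a ha har
    rcases hproj a ha r (Ne.symm har) htw hin hout with h | h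
    · exact absurd h hnot
    · exact h
  -- (3) no singleton `{a}` with `a ≠ r` is a difference
  have hsing : ∀ a ∈ u, a ≠ r → ({a} : Finset α) ∉ F \\ F := by
    intro a ha har h
    have h1 : r ∉ ({a} : Finset α) := by
      rw [mem_singleton]
      exact Ne.symm har
    apply hXY _ h h1
    rw [pair_comm]
    exact hpr a ha har
  -- (4) every `a ∈ u` with `a ≠ r` is nontrivial and twin-free
  have hnontriv : ∀ a ∈ u, a ≠ r → (∃ t ∈ F, a ∈ t) ∧ (∃ t ∈ F, a ∉ t) := by
    intro a ha har
    obtain ⟨t, ht, s, hs, hts⟩ := mem_diffs.1 (hpr a ha har)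
    have hat : a ∈ t \ s := by
      rw [hts]
      exact mem_insert_self a _
    rw [mem_sdiff] at hat
    exact ⟨⟨t, ht, hat.1⟩, ⟨s, hs, hat.2⟩⟩
  have htwfree : ∀ a ∈ u, a ≠ r → ∀ b, Twin F a b → b = a := by
    intro a ha har b hab
    by_cases hbr : b = r
    · rw [hbr] at hab
      exact absurd (htw a hab.symm) har
    · obtain ⟨t, ht, s, hs, hts⟩ := mem_diffs.1 (hpr a ha har)
      have hat : a ∈ t \ s := by
        rw [hts]
        exact mem_insert_self a _
      have hbt : b ∈ t \ s := by
        rw [mem_sdiff] at hat ⊢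
        exact ⟨(hab t ht).1 hat.1, fun hbs => hat.2 ((hab s hs).2 hbs)⟩
      rw [hts, mem_insert, mem_singleton] at hbt
      rcases hbt with hba | hbr'
      · exact hba
      · exact absurd hbr' hbr
  -- a second element `r'` of `u`
  obtain ⟨r', hr'u, hr'r⟩ : ∃ r' ∈ u, r' ≠ r := by
    by_contra hcon
    push Not at hcon
    obtain ⟨t, ht, hrt⟩ := hin
    obtain ⟨s, hs, hrs⟩ := hout
    apply hnot
    refine mem_diffs.2 ⟨t, ht, s, hs, ?_⟩
    ext x
    simp only [mem_sdiff, mem_singleton]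
    constructor
    · rintro ⟨hxt, -⟩
      exact hcon x (hFu t ht hxt)
    · rintro rfl
      exact ⟨hrt, hrs⟩
  -- (5) every pair `{a, r'}` with `a ∉ {r, r'}` is a difference
  have hpr' : ∀ a ∈ u, a ≠ r → a ≠ r' → insert a ({r'} : Finset α) ∈ F \\ F := by
    intro a ha har har'
    rcases hproj a ha r' (Ne.symm har') (htwfree r' hr'u hr'r) (hnontriv r' hr'u hr'r).1
        (hnontriv r' hr'u hr'r).2 with h | h
    · exact absurd h (hsing r' hr'u hr'r)
    · exact h
  -- (6) two further elements `a`, `b` of `u`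
  obtain ⟨t, ht, s, hs, hts⟩ := mem_diffs.1 (hpr r' hr'u hr'r)
  have hrt : r ∈ t ∧ r ∉ s := by
    have h : r ∈ t \ s := by
      rw [hts]
      exact mem_insert_of_mem (mem_singleton_self r)
    exact mem_sdiff.1 h
  have hr't : r' ∈ t ∧ r' ∉ s := by
    have h : r' ∈ t \ s := by
      rw [hts]
      exact mem_insert_self r' _
    exact mem_sdiff.1 h
  obtain ⟨a, hat, har, har'⟩ : ∃ a ∈ t, a ≠ r ∧ a ≠ r' := by
    by_contra hcon
    push Not at hcon
    have htsub : ∀ x ∈ t, x = r ∨ x = r' := by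
      intro x hx
      by_cases hxr : x = r
      · exact Or.inl hxr
      · exact Or.inr (hcon x hx hxr)
    -- otherwise `r` and `r'` are twins
    have htwin : Twin F r r' := by
      intro s'' hs''
      constructor
      · intro hrs''
        by_contra hr's''
        apply hsing r' hr'u hr'r
        refine mem_diffs.2 ⟨t, ht, s'', hs'', ?_⟩
        ext x
        simp only [mem_sdiff, mem_singleton]
        constructor
        · rintro ⟨hxt, hxs⟩
          rcases htsub x hxt with rfl | rfl
          · exact absurd hrs'' hxs
          · rfl
        · rintro rfl
          exact ⟨hr't.1, hr's''⟩
      · intro hr's''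
        by_contra hrs''
        apply hnot
        refine mem_diffs.2 ⟨t, ht, s'', hs'', ?_⟩
        ext x
        simp only [mem_sdiff, mem_singleton]
        constructor
        · rintro ⟨hxt, hxs⟩
          rcases htsub x hxt with rfl | rfl
          · rfl
          · exact absurd hr's'' hxs
        · rintro rfl
          exact ⟨hrt.1, hrs''⟩
    exact hr'r (htw r' htwin)
  have hau : a ∈ u := hFu t ht hat
  have has : a ∈ s := by
    by_contra h
    have h' : a ∈ t \ s := mem_sdiff.2 ⟨hat, h⟩
    rw [hts, mem_insert, mem_singleton] at h'
    rcases h' with h' | h'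
    · exact har' h'
    · exact har h'
  obtain ⟨b, hbu, hbr, hbr', hba⟩ : ∃ b ∈ u, b ≠ r ∧ b ≠ r' ∧ b ≠ a := by
    by_contra hcon
    push Not at hcon
    obtain ⟨s', hs', has'⟩ := (hnontriv a hau har).2
    apply hsing a hau har
    refine mem_diffs.2 ⟨s, hs, s', hs', ?_⟩
    ext x
    simp only [mem_sdiff, mem_singleton]
    constructor
    · rintro ⟨hxs, -⟩
      have hxr : x ≠ r := fun h => hrt.2 (h ▸ hxs)
      have hxr' : x ≠ r' := fun h => hr't.2 (h ▸ hxs)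
      exact hcon x (hFu s hs hxs) hxr hxr'
    · rintro rfl
      exact ⟨has, has'⟩
  -- (7) the count of the fibres of the projection along the pair `A = {r, r'}`
  set A : Finset α := insert r {r'} with hA
  have hrA : r ∈ A := mem_insert_self r _
  have hr'A : r' ∈ A := mem_insert_of_mem (mem_singleton_self r')
  have hmemA : ∀ x, x ∈ A ↔ x = r ∨ x = r' := by
    intro x
    rw [hA, mem_insert, mem_singleton]
  -- the only subsets of `A` among the differences are `∅` and `A`
  have hsubA : ∀ d ∈ F \\ F, d ⊆ A → d = ∅ ∨ d = A := by
    intro d hd hdA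
    by_cases hr : r ∈ d
    · by_cases hr' : r' ∈ d
      · right
        ext x
        constructor
        · intro hx
          exact hdA hx
        · intro hx
          rcases (hmemA x).1 hx with rfl | rfl
          · exact hr
          · exact hr'
      · exfalso
        apply hnot
        have hd' : d = {r} := by
          ext x
          rw [mem_singleton]
          constructor
          · intro hx
            rcases (hmemA x).1 (hdA hx) with rfl | rfl
            · rfl
            · exact absurd hx hr'
          · rintro rfl
            exact hr
        rw [← hd']
        exact hd
    · by_cases hr' : r' ∈ d
      · exfalso
        apply hsing r' hr'u hr'r
        have hd' : d = {r'} := by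
          ext x
          rw [mem_singleton]
          constructor
          · intro hx
            rcases (hmemA x).1 (hdA hx) with rfl | rfl
            · exact absurd hx hr
            · rfl
          · rintro rfl
            exact hr'
        rw [← hd']
        exact hd
      · left
        ext x
        simp only [notMem_empty, iff_false]
        intro hx
        rcases (hmemA x).1 (hdA hx) with rfl | rfl
        · exact hr hx
        · exact hr' hx
  have hnotA : ∀ x ∈ u \ A, x ≠ r ∧ x ≠ r' := by
    intro x hx
    rw [mem_sdiff, hmemA] at hx
    push Not at hx
    exact hx.2
  -- (7a) `|F| ≤ |Q| + |K'|`
  have hF_le := card_le_card_image_sdiff_add_card_diag F ⟨r, hrA⟩ hsubA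
  -- (7b) `|D_A| + |K' \\ K'| + |u \ A| ≤ |D|`
  have hD_ge := card_image_sdiff_add_card_diffs_diag_add_card_le F hrA hr'A (Ne.symm hr'r) u
    (fun x hx => hpr x (mem_sdiff.1 hx).1 (hnotA x hx).1)
    (fun x hx => hpr' x (mem_sdiff.1 hx).1 (hnotA x hx).1 (hnotA x hx).2)
    (fun x hx => hsing x (mem_sdiff.1 hx).1 (hnotA x hx).1)
  -- (7c) Marica–Schönheim for `Q` and `K'`, and the conclusion
  have hQD : ((F.image fun t => t \ A) \\ (F.image fun t => t \ A)).card =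
      ((F \\ F).image fun d => d \ A).card := by
    rw [diffs_image_sdiff]
  have hQ1 : (F.image fun t => t \ A).card ≤
      ((F.image fun t => t \ A) \\ (F.image fun t => t \ A)).card := card_le_card_diffs _
  have hK1 : (F.filter fun v => Disjoint v A ∧ v ∪ A ∈ F).card ≤
      ((F.filter fun v => Disjoint v A ∧ v ∪ A ∈ F) \\
        (F.filter fun v => Disjoint v A ∧ v ∪ A ∈ F)).card := card_le_card_diffs _
  have huA : 2 ≤ (u \ A).card := by
    refine one_lt_card.2 ⟨a, mem_sdiff.2 ⟨hau, ?_⟩, b, mem_sdiff.2 ⟨hbu, ?_⟩, hba.symm⟩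
    · rw [hmemA]
      push Not
      exact ⟨har, har'⟩
    · rw [hmemA]
      push Not
      exact ⟨hbr, hbr'⟩
  omega

/-- **(SD).** A family of Marica–Schönheim excess at most one (`|F \\ F| ≤ |F| + 1`) has every
nontrivial twin-free element `r` among its singleton differences: if `r` lies in some member and
outside some member and has no twin, then `{r} ∈ F \\ F`. -/
theorem singleton_mem_diffs_of_card_diffs_le {F : Finset (Finset α)}
    (hF : (F \\ F).card ≤ F.card + 1) {r : α} (htw : ∀ b, Twin F r b → b = r)
    (hin : ∃ t ∈ F, r ∈ t) (hout : ∃ t ∈ F, r ∉ t) : ({r} : Finset α) ∈ F \\ F :=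
  singleton_mem_diffs_of_card_diffs_le_aux univ F (fun _ _ => subset_univ _) hF r htw hin hout


/-- **Corollary (the tight-trace law of excess-one families).** If `|F \\ F| ≤ |F| + 1`, `r` is
a nontrivial twin-free element and the partner family at `r` is empty (no member containing
`r` has its `r`-free part a member), then the projection `proj r F` is tight. -/
theorem tight_proj_of_partner_eq_empty {F : Finset (Finset α)}
    (hF : (F \\ F).card ≤ F.card + 1) {r : α} (htw : ∀ b, Twin F r b → b = r)
    (hin : ∃ t ∈ F, r ∈ t) (hout : ∃ t ∈ F, r ∉ t) (hK : partner r F = ∅) :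
    Tight (proj r F) := by
  have hr : ({r} : Finset α) ∈ F \\ F := singleton_mem_diffs_of_card_diffs_le hF htw hin hout
  obtain ⟨t, ht, -⟩ := hin
  have h0 : (∅ : Finset α) ∈ diffsX r F ∩ diffsY r F := by
    refine mem_inter.2 ⟨mem_diffsX_iff.2 ⟨?_, notMem_empty r⟩, mem_diffsY_iff.2 ⟨notMem_empty r, ?_⟩⟩
    · exact mem_diffs.2 ⟨t, ht, t, ht, Finset.sdiff_self t⟩
    · rw [insert_empty]
      exact hr
  have h1 : 0 < (diffsX r F ∩ diffsY r F).card := card_pos.2 ⟨∅, h0⟩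
  have h2 := card_diffs_eq_card_diffs_proj_add r F
  have h3 : F.card = (proj r F).card := by
    rw [card_eq_card_proj_add_card_partner r F, hK, card_empty, add_zero]
  have h4 : (proj r F).card ≤ (proj r F \\ proj r F).card := card_le_card_diffs _
  unfold Tight
  omega

end PercRepro.MSTight
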